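import Mathlib
import Summits.CriticalPhenomena.SAWScalingLimit.Theorems.SAWDefectDecoherenceObservableToSLERSeqReduction

/-!
# The sequential reduction with tightness AND modulus, under an arbitrary family constraint
# `∀ P, CarvedSeqIdentificationPM P → MidTightN → MidModulusN → CarvedToSLENP P`

Stub `stub_seqReductionPM` (stub 5c of reshape r7) of the line `bridge-gate-renewal` for the crux
`Summit.CriticalPhenomena.SAWScalingLimit.Theses.SAWDefectDecoherence.ObservableToSLER`
(item `stmt-CriticalPhenomena-14005`).  Reshape r7 threads the injectivity MODULUS of the carved
laws like tightness: the sequential identification statement CSI-M assumes, along the selected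
sequence, both tightness of the carved curve laws and a uniform injectivity modulus
(`∀ ε' > 0, ∀ η > 0, ∃ θ > 0, ∀ᶠ k, carvedLaw_k {ξ | ξ.curve ∉ CurveClass.modulusClass ε' θ} ≤ η`),
and the reduction consumes, besides the averaged tightness `MidTightN`, the averaged modulus
`MidModulusN`.  This is a port of the landed r6 stub `stub_seqReductionP`
(`Theorems/SAWDefectDecoherenceObservableToSLERSeqReductionP.lean`, p117919; r5 parent with the
helper lemmas `Theorems/SAWDefectDecoherenceObservableToSLERSeqReduction.lean`, p117288).

Proof (by contradiction, as r5/r6).  `R₀ := min R₀^CSI (min R₁ (min R₂ R₃))` (`R₁` of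
`eventually_productCellN`, `R₂` of `MidTightN`, `R₃` of `MidModulusN`).  If the eventual clause
fails at `(R, ρ, N)`, `Filter.exists_seq_forall_of_frequently` extracts meshes `δ_k → 0⁺` with
product cells and bad tame `P`-families `S_k, T_k` (`P_k(Bad) > ε`).  TWO countable families of
bad-cell events are then removed along the selection (`SeqReduction.exists_seq_mem_diff₂`, the
two-family corollary of the landed `SeqReduction.exists_seq_mem_diff` — remove the union): the
non-tight events at the levels `η_j := ε/2/2^{j+1}` (compact `𝒦_j`, index `K_j` from `MidTightN`)
and the non-modulus events at the levels `(ε_l, η_l)`, `ε_l := 1/((Nat.unpair l).1 + 1)` (modulus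
`θ_l`, index `K'_l` from `MidModulusN`); each family has partial sums `≤ ε/2`
(`sum_ofReal_div_two_pow_le`).  The selected bad walk `γ_k` has an `ε`-bad label realised with a
wide link, a probability carved law (`isProbabilityMeasure_carvedLaw_of_isFirstGoodGateN`), tight
at every level eventually, and — for given `(ε', η)`, with `1/(i+1) < ε'` (`exists_nat_one_div_lt`),
`η_j ≤ η` (`exists_div_two_pow_le`), `l := Nat.pair i j ≥ j` (`Nat.right_le_pair`,
`Nat.unpair_pair`) and `CurveClass.modulusClass_mono` — with modulus `(ε', θ_l)` up to mass `η`
eventually: the two hypotheses of CSI-M, which bounds the carved `f`-integral by `ε` eventually —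
contradiction.
-/

noncomputable section

open scoped BigOperators Topology NNReal ENNReal Classical BoundedContinuousFunction
open Filter Set MeasureTheory Metric
open Literature.Probability.LatticeModels (HexVertex hexGraph hexCenter triZeta Site)
open Literature.Probability.RandomPlanarGeometry
open Literature.Probability.RandomPlanarGeometry.SAW

namespace Summit.CriticalPhenomena.SAWScalingLimit.Theorems.ObservableToSLER.NestedGate

open Summit.CriticalPhenomena.SAWScalingLimit.Theorems.ObservableToSLE.Negative
  (finite_hexDomainSAW)
open Summit.CriticalPhenomena.SAWScalingLimit.Theorems.ObservableToSLER.BridgeGate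

namespace SeqReduction

/-- **Selection along a sequence, two countable families.**  Measures `P k`, events `A k` of
mass `> e`, and two countably indexed families of events `B₁ j k`, `B₂ j k` with
`P k (B₁ j k) ≤ η₁ j` from the index `K₁ j` on, `P k (B₂ j k) ≤ η₂ j` from `K₂ j` on, whose
partial sums stay `≤ e₁`, `≤ e₂` with `e₁ + e₂ ≤ e`: there is a sequence `x k ∈ A k` avoiding,
for every `j`, both `B₁ j k` and `B₂ j k` for all large `k`.  (The one-family lemma
`exists_seq_mem_diff` applied to the unions `B₁ j k ∪ B₂ j k` from `max (K₁ j) (K₂ j)` on.) -/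
theorem exists_seq_mem_diff₂ {X : ℕ → Type*} [∀ k, MeasurableSpace (X k)]
    (P : ∀ k, Measure (X k)) (A : ∀ k, Set (X k)) (B₁ B₂ : ℕ → ∀ k, Set (X k)) (K₁ K₂ : ℕ → ℕ)
    {e e₁ e₂ : ℝ≥0∞} {η₁ η₂ : ℕ → ℝ≥0∞} (hA : ∀ k, e < P k (A k))
    (hB₁ : ∀ j k, K₁ j ≤ k → P k (B₁ j k) ≤ η₁ j) (hB₂ : ∀ j k, K₂ j ≤ k → P k (B₂ j k) ≤ η₂ j)
    (hη₁ : ∀ n, ∑ j ∈ Finset.range n, η₁ j ≤ e₁) (hη₂ : ∀ n, ∑ j ∈ Finset.range n, η₂ j ≤ e₂)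
    (he : e₁ + e₂ ≤ e) :
    ∃ x : ∀ k, X k, (∀ k, x k ∈ A k) ∧ (∀ j, ∀ᶠ k in atTop, x k ∉ B₁ j k) ∧
      ∀ j, ∀ᶠ k in atTop, x k ∉ B₂ j k := by
  obtain ⟨x, hxA, hxB⟩ := exists_seq_mem_diff P A (fun j k => B₁ j k ∪ B₂ j k)
    (fun j => max (K₁ j) (K₂ j)) (η := fun j => η₁ j + η₂ j) hA
    (fun j k hjk => (measure_union_le _ _).trans
      (add_le_add (hB₁ j k ((le_max_left _ _).trans hjk))
        (hB₂ j k ((le_max_right _ _).trans hjk))))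
    (fun n => by
      rw [Finset.sum_add_distrib]
      exact (add_le_add (hη₁ n) (hη₂ n)).trans he)
  exact ⟨x, hxA, fun j => (hxB j).mono fun k hk h => hk (Or.inl h),
    fun j => (hxB j).mono fun k hk h => hk (Or.inr h)⟩

end SeqReduction

open SeqReduction

/-- **STUB 5c of the line `bridge-gate-renewal` (reshape r7): the sequential reduction with
tightness and modulus, under an arbitrary family constraint `P`** — `CarvedSeqIdentificationPM P`
(identification cell-wise along sequences of meshes with tame `P`-families, labels realised as
widely linked first good gates, probability carved laws whose curve laws are tight AND carry a
uniform injectivity modulus eventually), `MidTightN` (averaged tightness of the carved middle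
pieces) and `MidModulusN` (averaged modulus of the carved middle pieces) imply `CarvedToSLENP P`
(the eventual, uniform-in-family bound consumed by the nested transfer).  By contradiction along a
bad sequence of meshes, exactly as the r6 `stub_seqReductionP`, removing along the selection a
second countable family of bad-cell events (the non-modulus events at the levels
`(1/((Nat.unpair l).1 + 1), ε/2/2^{l+1})`) together with the non-tight events. -/
theorem stub_seqReductionPM :
    ∀ (P : DobrushinDomain → (ℝ → HexVertex) → (ℝ → HexVertex) → ℝ → ℝ → ℝ → ℕ →
      (ℕ → Set HexVertex) → (ℕ → Set HexVertex) → Prop),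
    (∀ (D : DobrushinDomain) (a b : ℝ → HexVertex), IsEmbEndpointApprox hexGraph hexCenter D a b →
        ∀ (ν : Measure (CurveClass ℂ)), IsSLELaw ((8 : ℝ≥0) / 3) D ν →
        ∀ (f : CurveClass ℂ →ᵇ ℝ) (ε : ℝ), 0 < ε →
          ∃ R₀ > (0 : ℝ), ∀ R ∈ Set.Ioc (0 : ℝ) R₀, ∀ ρ > (0 : ℝ), ∀ N : ℕ,
            ∀ (δ : ℕ → ℝ) (S T : ℕ → ℕ → Set HexVertex) (n n' : ℕ → ℕ) (q q' : ℕ → HexVertex),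
              Tendsto δ atTop (𝓝[>] 0) →
              (∀ k, TameNestedFamily (δ k) R N (a (δ k)) (S k) ∧
                TameNestedFamily (δ k) R N (b (δ k)) (T k) ∧
                P D a b (δ k) ρ R N (S k) (T k)) →
              (∀ k, ∃ (γ : HexDomainSAW D.carrier (δ k) (a (δ k)) (b (δ k))) (m : ℕ) (p : HexVertex)
                  (m' : ℕ) (p' : HexVertex),
                IsFirstGoodGateN D.carrier (δ k) ρ R (S k) (a (δ k)) γ.walk.support (n k) m p (q k) ∧
                IsFirstGoodGateN D.carrier (δ k) ρ R (T k) (b (δ k)) γ.walk.support.reverse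
                  (n' k) m' p' (q' k) ∧
                WideLink D.carrier (δ k) ρ (S k (n k) ∪ T k (n' k)) (q k) (q' k)) →
              (∀ k, IsProbabilityMeasure
                (carvedLaw D.carrier (δ k) (S k (n k) ∪ T k (n' k)) (q k) (q' k))) →
              (∀ η > (0 : ℝ), ∃ 𝒦 : Set (CurveClass ℂ), IsCompact 𝒦 ∧ ∀ᶠ k in atTop,
                carvedLaw D.carrier (δ k) (S k (n k) ∪ T k (n' k)) (q k) (q' k)
                  {ξ | ξ.curve ∉ 𝒦} ≤ ENNReal.ofReal η) →
              (∀ ε' > (0 : ℝ), ∀ η > (0 : ℝ), ∃ θ > (0 : ℝ), ∀ᶠ k in atTop,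
                carvedLaw D.carrier (δ k) (S k (n k) ∪ T k (n' k)) (q k) (q' k)
                  {ξ | ξ.curve ∉ CurveClass.modulusClass ε' θ} ≤ ENNReal.ofReal η) →
              ∀ᶠ k in atTop,
                |(∫ ξ, f ξ.curve ∂(carvedLaw D.carrier (δ k) (S k (n k) ∪ T k (n' k)) (q k) (q' k))) -
                    ∫ x, f x ∂ν| ≤ ε) →
    (∀ (D : DobrushinDomain) (a b : ℝ → HexVertex), IsEmbEndpointApprox hexGraph hexCenter D a b →
        ∃ R₂ > (0 : ℝ), ∀ R ∈ Set.Ioc (0 : ℝ) R₂, ∀ ρ > (0 : ℝ), ∀ N : ℕ, ∀ η > (0 : ℝ),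
          ∃ 𝒦 : Set (CurveClass ℂ), IsCompact 𝒦 ∧
            ∀ᶠ δ : ℝ in 𝓝[>] 0, ∀ S T : ℕ → Set HexVertex,
              TameNestedFamily δ R N (a δ) S → TameNestedFamily δ R N (b δ) T →
              hexSAWLaw D.carrier δ (a δ) (b δ)
                {γ | ∃ (n m : ℕ) (p q : HexVertex) (n' m' : ℕ) (p' q' : HexVertex),
                    IsFirstGoodGateN D.carrier δ ρ R S (a δ) γ.walk.support n m p q ∧
                    IsFirstGoodGateN D.carrier δ ρ R T (b δ) γ.walk.support.reverse n' m' p' q' ∧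
                    ENNReal.ofReal η <
                      carvedLaw D.carrier δ (S n ∪ T n') q q' {ξ | ξ.curve ∉ 𝒦}} ≤
                ENNReal.ofReal η) →
    (∀ (D : DobrushinDomain) (a b : ℝ → HexVertex), IsEmbEndpointApprox hexGraph hexCenter D a b →
        ∃ R₃ > (0 : ℝ), ∀ R ∈ Set.Ioc (0 : ℝ) R₃, ∀ ρ > (0 : ℝ), ∀ N : ℕ, ∀ ε > (0 : ℝ), ∀ η > (0 : ℝ),
          ∃ θ > (0 : ℝ),
            ∀ᶠ δ : ℝ in 𝓝[>] 0, ∀ S T : ℕ → Set HexVertex,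
              TameNestedFamily δ R N (a δ) S → TameNestedFamily δ R N (b δ) T →
              hexSAWLaw D.carrier δ (a δ) (b δ)
                {γ | ∃ (n m : ℕ) (p q : HexVertex) (n' m' : ℕ) (p' q' : HexVertex),
                    IsFirstGoodGateN D.carrier δ ρ R S (a δ) γ.walk.support n m p q ∧
                    IsFirstGoodGateN D.carrier δ ρ R T (b δ) γ.walk.support.reverse n' m' p' q' ∧
                    ENNReal.ofReal η <
                      carvedLaw D.carrier δ (S n ∪ T n') q q'
                        {ξ | ξ.curve ∉ CurveClass.modulusClass ε θ}} ≤
                ENNReal.ofReal η) →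
    ∀ (D : DobrushinDomain) (a b : ℝ → HexVertex), IsEmbEndpointApprox hexGraph hexCenter D a b →
      ∀ (ν : Measure (CurveClass ℂ)), IsSLELaw ((8 : ℝ≥0) / 3) D ν →
      ∀ (f : CurveClass ℂ →ᵇ ℝ) (ε : ℝ), 0 < ε →
        ∃ R₀ > (0 : ℝ), ∀ R ∈ Set.Ioc (0 : ℝ) R₀, ∀ ρ > (0 : ℝ), ∀ N : ℕ,
          ∀ᶠ δ : ℝ in 𝓝[>] 0, ∀ S T : ℕ → Set HexVertex,
            TameNestedFamily δ R N (a δ) S → TameNestedFamily δ R N (b δ) T →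
            P D a b δ ρ R N S T →
            hexSAWLaw D.carrier δ (a δ) (b δ)
              {γ | ∃ (n m : ℕ) (p q : HexVertex) (n' m' : ℕ) (p' q' : HexVertex),
                  IsFirstGoodGateN D.carrier δ ρ R S (a δ) γ.walk.support n m p q ∧
                  IsFirstGoodGateN D.carrier δ ρ R T (b δ) γ.walk.support.reverse n' m' p' q' ∧
                  WideLink D.carrier δ ρ (S n ∪ T n') q q' ∧
                  ε < |(∫ ξ, f ξ.curve ∂(carvedLaw D.carrier δ (S n ∪ T n') q q')) - ∫ x, f x ∂ν|} ≤
              ENNReal.ofReal ε := by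
  intro P hCSI hMT hMM D a b hab ν hν f ε hε
  obtain ⟨R₀', hR₀', hC⟩ := hCSI D a b hab ν hν f ε hε
  obtain ⟨R₁, hR₁, hcells⟩ := eventually_productCellN D a b hab
  obtain ⟨R₂, hR₂, hM⟩ := hMT D a b hab
  obtain ⟨R₃, hR₃, hMo⟩ := hMM D a b hab
  refine ⟨min R₀' (min R₁ (min R₂ R₃)), lt_min hR₀' (lt_min hR₁ (lt_min hR₂ hR₃)), ?_⟩
  rintro R ⟨hR0, hRle⟩ ρ hρ N
  have hRR₀' : R ∈ Set.Ioc 0 R₀' := ⟨hR0, hRle.trans (min_le_left _ _)⟩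
  have hRR₁ : R ∈ Set.Ioc 0 R₁ := ⟨hR0, hRle.trans ((min_le_right _ _).trans (min_le_left _ _))⟩
  have hRR₂ : R ∈ Set.Ioc 0 R₂ :=
    ⟨hR0, hRle.trans ((min_le_right _ _).trans ((min_le_right _ _).trans (min_le_left _ _)))⟩
  have hRR₃ : R ∈ Set.Ioc 0 R₃ :=
    ⟨hR0, hRle.trans ((min_le_right _ _).trans ((min_le_right _ _).trans (min_le_right _ _)))⟩
  by_contra hnot
  -- STEP 1: a sequence of meshes `δ_k → 0⁺` with product cells and bad tame `P`-families
  have hev : ∀ᶠ δ : ℝ in 𝓝[>] 0, 0 < δ ∧ ∀ S T : ℕ → Set HexVertex,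
      TameNestedFamily δ R N (a δ) S → TameNestedFamily δ R N (b δ) T →
        ∀ γ₀ : HexDomainSAW D.carrier δ (a δ) (b δ),
          γ₀ ∈ productCellN D.carrier δ ρ R S T (a δ) (b δ) (3 * R) := by
    filter_upwards [self_mem_nhdsWithin, hcells R hRR₁ ρ N] with δ hδ hc
    exact ⟨hδ, hc⟩
  obtain ⟨δs, hδs, hk⟩ :=
    exists_seq_forall_of_frequently ((not_eventually.1 hnot).and_eventually hev)
  have hk' : ∀ k, ∃ S T : ℕ → Set HexVertex, TameNestedFamily (δs k) R N (a (δs k)) S ∧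
      TameNestedFamily (δs k) R N (b (δs k)) T ∧
      P D a b (δs k) ρ R N S T ∧
      ENNReal.ofReal ε < hexSAWLaw D.carrier (δs k) (a (δs k)) (b (δs k))
        {γ | ∃ (n m : ℕ) (p q : HexVertex) (n' m' : ℕ) (p' q' : HexVertex),
            IsFirstGoodGateN D.carrier (δs k) ρ R S (a (δs k)) γ.walk.support n m p q ∧
            IsFirstGoodGateN D.carrier (δs k) ρ R T (b (δs k)) γ.walk.support.reverse
              n' m' p' q' ∧
            WideLink D.carrier (δs k) ρ (S n ∪ T n') q q' ∧
            ε < |(∫ ξ, f ξ.curve ∂(carvedLaw D.carrier (δs k) (S n ∪ T n') q q')) -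
              ∫ x, f x ∂ν|} := by
    intro k
    have h := (hk k).1
    push Not at h
    obtain ⟨S, T, hS, hT, hP, hlt⟩ := h
    exact ⟨S, T, hS, hT, hP, hlt⟩
  choose S T hS hT hP hbad using hk'
  -- STEP 2: the averaged tightness at the levels `η_j := ε / 2 / 2^(j+1)`, from an index `K_j` on
  obtain ⟨ηs, hηs⟩ : ∃ ηs : ℕ → ℝ, ∀ j, ηs j = ε / 2 / 2 ^ (j + 1) := ⟨_, fun j => rfl⟩
  have hηpos : ∀ j, 0 < ηs j := fun j => by rw [hηs]; positivity
  have hηanti : ∀ j l, j ≤ l → ηs l ≤ ηs j := fun j l hjl => by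
    rw [hηs, hηs]
    exact div_le_div_of_nonneg_left (by positivity) (by positivity)
      (pow_le_pow_right₀ one_le_two (by omega))
  have hηsum : ∀ n, ∑ j ∈ Finset.range n, ENNReal.ofReal (ηs j) ≤ ENNReal.ofReal (ε / 2) :=
    fun n => by simp_rw [hηs]; exact sum_ofReal_div_two_pow_le (by positivity) n
  have hεhalf : ENNReal.ofReal (ε / 2) + ENNReal.ofReal (ε / 2) ≤ ENNReal.ofReal ε := by
    rw [← ENNReal.ofReal_add (by positivity) (by positivity), add_halves]
  have hj : ∀ j : ℕ, ∃ 𝒦 : Set (CurveClass ℂ), IsCompact 𝒦 ∧ ∃ Kj : ℕ, ∀ k ≥ Kj,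
      ∀ S T : ℕ → Set HexVertex, TameNestedFamily (δs k) R N (a (δs k)) S →
        TameNestedFamily (δs k) R N (b (δs k)) T →
        hexSAWLaw D.carrier (δs k) (a (δs k)) (b (δs k))
          {γ | ∃ (n m : ℕ) (p q : HexVertex) (n' m' : ℕ) (p' q' : HexVertex),
              IsFirstGoodGateN D.carrier (δs k) ρ R S (a (δs k)) γ.walk.support n m p q ∧
              IsFirstGoodGateN D.carrier (δs k) ρ R T (b (δs k)) γ.walk.support.reverse
                n' m' p' q' ∧
              ENNReal.ofReal (ηs j) <
                carvedLaw D.carrier (δs k) (S n ∪ T n') q q' {ξ | ξ.curve ∉ 𝒦}} ≤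
          ENNReal.ofReal (ηs j) := by
    intro j
    obtain ⟨𝒦, h𝒦, hevj⟩ := hM R hRR₂ ρ hρ N (ηs j) (hηpos j)
    exact ⟨𝒦, h𝒦, eventually_atTop.1 (hδs.eventually hevj)⟩
  choose 𝒦 h𝒦 K hK using hj
  -- STEP 2': the averaged modulus at the levels `(ε_l, η_l)`, `ε_l := 1 / ((unpair l).1 + 1)`,
  -- from an index `K'_l` on
  obtain ⟨εs, hεs⟩ : ∃ εs : ℕ → ℝ, ∀ l, εs l = 1 / ((Nat.unpair l).1 + 1 : ℝ) :=
    ⟨_, fun l => rfl⟩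
  have hεpos : ∀ l, 0 < εs l := fun l => by rw [hεs]; positivity
  have hl : ∀ l : ℕ, ∃ θ > (0 : ℝ), ∃ Kl : ℕ, ∀ k ≥ Kl,
      ∀ S T : ℕ → Set HexVertex, TameNestedFamily (δs k) R N (a (δs k)) S →
        TameNestedFamily (δs k) R N (b (δs k)) T →
        hexSAWLaw D.carrier (δs k) (a (δs k)) (b (δs k))
          {γ | ∃ (n m : ℕ) (p q : HexVertex) (n' m' : ℕ) (p' q' : HexVertex),
              IsFirstGoodGateN D.carrier (δs k) ρ R S (a (δs k)) γ.walk.support n m p q ∧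
              IsFirstGoodGateN D.carrier (δs k) ρ R T (b (δs k)) γ.walk.support.reverse
                n' m' p' q' ∧
              ENNReal.ofReal (ηs l) <
                carvedLaw D.carrier (δs k) (S n ∪ T n') q q'
                  {ξ | ξ.curve ∉ CurveClass.modulusClass (εs l) θ}} ≤
          ENNReal.ofReal (ηs l) := by
    intro l
    obtain ⟨θ, hθ, hevl⟩ := hMo R hRR₃ ρ hρ N (εs l) (hεpos l) (ηs l) (hηpos l)
    exact ⟨θ, hθ, eventually_atTop.1 (hδs.eventually hevl)⟩
  choose θ hθ K' hK' using hl
  -- STEP 3: selection of a bad walk, tight and with modulus at every active level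
  obtain ⟨γ, hγA, hγB, hγB'⟩ := exists_seq_mem_diff₂
    (fun k => hexSAWLaw D.carrier (δs k) (a (δs k)) (b (δs k)))
    (fun k => {γ | ∃ (n m : ℕ) (p q : HexVertex) (n' m' : ℕ) (p' q' : HexVertex),
      IsFirstGoodGateN D.carrier (δs k) ρ R (S k) (a (δs k)) γ.walk.support n m p q ∧
      IsFirstGoodGateN D.carrier (δs k) ρ R (T k) (b (δs k)) γ.walk.support.reverse
        n' m' p' q' ∧
      WideLink D.carrier (δs k) ρ (S k n ∪ T k n') q q' ∧
      ε < |(∫ ξ, f ξ.curve ∂(carvedLaw D.carrier (δs k) (S k n ∪ T k n') q q')) -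
        ∫ x, f x ∂ν|})
    (fun j k => {γ | ∃ (n m : ℕ) (p q : HexVertex) (n' m' : ℕ) (p' q' : HexVertex),
      IsFirstGoodGateN D.carrier (δs k) ρ R (S k) (a (δs k)) γ.walk.support n m p q ∧
      IsFirstGoodGateN D.carrier (δs k) ρ R (T k) (b (δs k)) γ.walk.support.reverse
        n' m' p' q' ∧
      ENNReal.ofReal (ηs j) <
        carvedLaw D.carrier (δs k) (S k n ∪ T k n') q q' {ξ | ξ.curve ∉ 𝒦 j}})
    (fun l k => {γ | ∃ (n m : ℕ) (p q : HexVertex) (n' m' : ℕ) (p' q' : HexVertex),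
      IsFirstGoodGateN D.carrier (δs k) ρ R (S k) (a (δs k)) γ.walk.support n m p q ∧
      IsFirstGoodGateN D.carrier (δs k) ρ R (T k) (b (δs k)) γ.walk.support.reverse
        n' m' p' q' ∧
      ENNReal.ofReal (ηs l) <
        carvedLaw D.carrier (δs k) (S k n ∪ T k n') q q'
          {ξ | ξ.curve ∉ CurveClass.modulusClass (εs l) (θ l)}})
    K K' hbad (fun j k hjk => hK j k hjk (S k) (T k) (hS k) (hT k))
    (fun l k hlk => hK' l k hlk (S k) (T k) (hS k) (hT k)) hηsum hηsum hεhalf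
  have hγA' : ∀ k, ∃ (n m : ℕ) (p q : HexVertex) (n' m' : ℕ) (p' q' : HexVertex),
      IsFirstGoodGateN D.carrier (δs k) ρ R (S k) (a (δs k)) (γ k).walk.support n m p q ∧
      IsFirstGoodGateN D.carrier (δs k) ρ R (T k) (b (δs k)) (γ k).walk.support.reverse
        n' m' p' q' ∧
      WideLink D.carrier (δs k) ρ (S k n ∪ T k n') q q' ∧
      ε < |(∫ ξ, f ξ.curve ∂(carvedLaw D.carrier (δs k) (S k n ∪ T k n') q q')) -
        ∫ x, f x ∂ν| := fun k => hγA k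
  choose n m p q n' m' p' q' hFG hFG' hWL hεlt using hγA'
  -- STEP 4: the hypotheses of CSI-M along the selected labels
  have hprob : ∀ k, IsProbabilityMeasure
      (carvedLaw D.carrier (δs k) (S k (n k) ∪ T k (n' k)) (q k) (q' k)) := fun k =>
    isProbabilityMeasure_carvedLaw_of_isFirstGoodGateN D.isBounded (hk k).2.1
      ((hk k).2.2 (S k) (T k) (hS k) (hT k) (γ k)) (hFG k) (hFG' k)
  have htight : ∀ η > (0 : ℝ), ∃ 𝒦' : Set (CurveClass ℂ), IsCompact 𝒦' ∧ ∀ᶠ k in atTop,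
      carvedLaw D.carrier (δs k) (S k (n k) ∪ T k (n' k)) (q k) (q' k)
        {ξ | ξ.curve ∉ 𝒦'} ≤ ENNReal.ofReal η := by
    intro η hη
    obtain ⟨j, hjη⟩ := exists_div_two_pow_le (ε / 2) hη
    rw [← hηs] at hjη
    refine ⟨𝒦 j, h𝒦 j, (hγB j).mono fun k hk => ?_⟩
    simp only [Set.mem_setOf_eq, not_exists, not_and, not_lt] at hk
    exact (hk _ _ _ _ _ _ _ _ (hFG k) (hFG' k)).trans (ENNReal.ofReal_le_ofReal hjη)
  have hmod : ∀ ε' > (0 : ℝ), ∀ η > (0 : ℝ), ∃ θ' > (0 : ℝ), ∀ᶠ k in atTop,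
      carvedLaw D.carrier (δs k) (S k (n k) ∪ T k (n' k)) (q k) (q' k)
        {ξ | ξ.curve ∉ CurveClass.modulusClass ε' θ'} ≤ ENNReal.ofReal η := by
    intro ε' hε' η hη
    obtain ⟨i, hi⟩ := exists_nat_one_div_lt hε'
    obtain ⟨j, hjη⟩ := exists_div_two_pow_le (ε / 2) hη
    rw [← hηs] at hjη
    have hl1 : (Nat.unpair (Nat.pair i j)).1 = i := by rw [Nat.unpair_pair]
    have hεl : εs (Nat.pair i j) ≤ ε' := by rw [hεs, hl1]; exact hi.le
    have hηl : ηs (Nat.pair i j) ≤ η := (hηanti j _ (Nat.right_le_pair i j)).trans hjη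
    refine ⟨θ (Nat.pair i j), hθ _, (hγB' (Nat.pair i j)).mono fun k hk => ?_⟩
    simp only [Set.mem_setOf_eq, not_exists, not_and, not_lt] at hk
    calc carvedLaw D.carrier (δs k) (S k (n k) ∪ T k (n' k)) (q k) (q' k)
          {ξ | ξ.curve ∉ CurveClass.modulusClass ε' (θ (Nat.pair i j))}
        ≤ carvedLaw D.carrier (δs k) (S k (n k) ∪ T k (n' k)) (q k) (q' k)
            {ξ | ξ.curve ∉ CurveClass.modulusClass (εs (Nat.pair i j)) (θ (Nat.pair i j))} :=
          measure_mono fun ξ hξ h => hξ (CurveClass.modulusClass_mono hεl le_rfl h)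
      _ ≤ ENNReal.ofReal (ηs (Nat.pair i j)) := hk _ _ _ _ _ _ _ _ (hFG k) (hFG' k)
      _ ≤ ENNReal.ofReal η := ENNReal.ofReal_le_ofReal hηl
  -- STEP 5: CSI-M bounds the carved integrals eventually; contradiction with badness
  have hconc := hC R hRR₀' ρ hρ N δs S T n n' q q' hδs (fun k => ⟨hS k, hT k, hP k⟩)
    (fun k => ⟨γ k, m k, p k, m' k, p' k, hFG k, hFG' k, hWL k⟩) hprob htight hmod
  obtain ⟨k, hk⟩ := hconc.exists
  exact (not_lt.2 hk) (hεlt k)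

end Summit.CriticalPhenomena.SAWScalingLimit.Theorems.ObservableToSLER.NestedGate

end
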